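import Summits.ResolutionOfSingularities.ResolutionOfSingularities.Theorems.FrobeniusClosingPatchingRelPerfectDepthSNCPointwise
import Literature.AlgebraicGeometry.Resolution.MarkedIdealsLemmas
import Literature.AlgebraicGeometry.Resolution.HypersurfaceRestrictionTransform
import Literature.AlgebraicGeometry.Resolution.HypersurfaceTransform
import Literature.AlgebraicGeometry.Resolution.SncSaturatedCentre
import Literature.AlgebraicGeometry.Resolution.KollarHypersurfaceTriple
import Literature.AlgebraicGeometry.Resolution.KollarMaxContactPersistence
import Literature.AlgebraicGeometry.Resolution.KollarBoundaryCentre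
import Literature.AlgebraicGeometry.Resolution.RsopMonomialIdeals
import Literature.AlgebraicGeometry.Resolution.MonomialMarkedIdealsBlowupGeneral
import HarnessLib

/-!
# Crux `PatchingRelPerfect` (stmt-ResolutionOfSingularities-16161), chain W5.2 — rung R4♭ / F6 STAGE 2 (TargetsF6 part S,
# target T6-E2 `SeparationBoundary₃`): ONE PEEL — blowing up a member of an snc family is the identity, and every clause of the
# weight-one step is read off the snc chart

[OURS · L1 W5.2 · rung tool] Replaces the role of NO printed item; NOT a statement of the manuscript under review;
fact-free, format-free (no `IsSepSeq` names), any (locally Noetherian) scheme.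

THE PEEL (res-L1-w52-plan-1 F6-DESIGN-MEMO c3041ebc §2.3 / TargetsF6 part S v0 078cf7ab, route (2) of `SeparationBoundary₃`).
On the regular threefold `E'` the E-side datum of stage 2 is a locally principal ideal `𝔟'`; once every component of `V(𝔟')` is
a regular surface and the whole configuration «components of `V(𝔟')` ++ boundary traces» is simple normal crossings, the
driver PEELS: the centre is a surface `S` with `𝔟' ≤ S`, the blow-up along the effective Cartier divisor `S` is the
identity, the new datum is `(𝔟' : S)` and `S` joins the boundary with N-exponent `+1`.  This file supplies, for a member
`S` of an snc family `𝓔` on a scheme `X`: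

* §1 THE BLOW-UP IS THE IDENTITY: `isBlowup_id_of_mem`; the transforms along `𝟙 X`: `controlledTransform_id`
  (`= colon 𝔟 S`), `strictTransformIdeal_id_self` (`= ⊤`), `strictTransformIdeal_id_of_ne` (`= G` for another member `G`),
  `colon_mul_of_isEffectiveCartier` (`(S · M : S) = M`), `colon_monomialIdeal_cons_succ` (one exponent comes off).
* §2 THE STEP CLAUSES: `monomialIdeal_le_of_mem` (`Π Sᵢ^{eᵢ} ≤ S` if `e_S ≥ 1`), `hasSNCWith_of_subset_of_mem` (snc of any
  sub-family WITH the centre `S`), `uniformPieces_single_of_hasSNC` (uniform incidence of a boundary with the centre `S` on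
  the single piece `V(S)`), and the JOINT data at a point `z ∈ V(S)` of ORDER ONE: `stalkIdeal_eq_of_le_of_not_le_sq`
  (`𝔟 ≤ S ∧ 𝔟_z ⊄ 𝔪_z² ⇒ 𝔟_z = S_z`) and `sncWithAt_cons_of_stalkIdeal_eq` (`SNCWithAt (S :: 𝒢) C z ⇒ SNCWithAt (𝔟 :: 𝒢) C z`
  when `𝔟_z = S_z` and `S ∉ 𝒢`), `sncWithAt_cons_self` (the family `S :: 𝒢` WITH centre `S`).
* §3 BOOKKEEPING FOR THE NEXT PEEL: `hasSNC_of_forall_mem_or_eq_top` (families drawn from `𝓔 ∪ {⊤}` stay snc),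
  `mem_or_eq_top_of_mem_boundaryOf_peel` (the new boundary list is drawn from `𝓔 ∪ {⊤}`).

USE: res-L1-w52-stub-1's Phase B «PEEL-ALL» of T6-E2 (the by-name induction over `IsSepSeq` lands on TargetsF6's names).

## References
* J. Kollár, *Lectures on Resolution of Singularities* (2007), (3.111) Step 3 (monomial part, blowing up divisors),
  Def. 3.24 (simple normal crossings). [Kollar2007]
* U. Görtz, T. Wedhorn, *Algebraic Geometry I* (2020), (13.19) p. 413 (the blow-up of an effective Cartier divisor is
  the identity). [GortzWedhorn2020]
-/

-- `Summit.<Summit>.<Sub>.Theorems` with `Sub = Summit` (single-conjunct summit, D-0017)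
set_option linter.dupNamespace false

noncomputable section

open CategoryTheory AlgebraicGeometry TopologicalSpace IsLocalRing
open Literature.AlgebraicGeometry.Resolution

namespace Summit.ResolutionOfSingularities.ResolutionOfSingularities.Theorems

universe u

namespace DepthSep

variable {X : Scheme.{u}}

/-! ## §0 Two stalk facts about snc families -/

/-- Distinct members of an snc family through a point have INCOMPARABLE stalks (their generators are two distinct
members of one regular system of parameters, neither dividing the other). [cite: Kollar2007, Def. 3.24] -/
theorem stalkIdeal_not_le_of_ne {𝓔 : List X.IdealSheafData} {C : X.IdealSheafData} (h : HasSNCWith 𝓔 C)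
    {D D' : X.IdealSheafData} (hD : D ∈ 𝓔) (hD' : D' ∈ 𝓔) (hne : D ≠ D') {x : X} (hx : x ∈ D.support)
    (hx' : x ∈ D'.support) : ¬ stalkIdeal D x ≤ stalkIdeal D' x := by
  obtain ⟨hreg, u, hu, ⟨ι, hι, hιD⟩, -⟩ := h x
  haveI := hreg
  have hrsop : IsRsopPart (u ∘ id) := isRsopPart_comp_of_rsop rfl u hu id Function.injective_id
  have hab : ι ⟨D', hD', hx'⟩ ≠ ι ⟨D, hD, hx⟩ := fun heq => hne (congrArg Subtype.val (hι heq)).symm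
  intro hle
  have hmem : u (ι ⟨D, hD, hx⟩) ∈ Ideal.span {u (ι ⟨D', hD', hx'⟩)} := by
    rw [← hιD ⟨D', hD', hx'⟩]
    exact hle (hιD ⟨D, hD, hx⟩ ▸ Ideal.mem_span_singleton_self _)
  exact hrsop.not_dvd hab (Ideal.mem_span_singleton.mp hmem)

/-- **`(P : Qⁿ) = P`** for a prime ideal `P` and an ideal `Q ⊄ P`. [folklore] -/
theorem colon_pow_eq_self_of_isPrime_of_not_le {A : Type*} [CommRing A] {P Q : Ideal A}
    (hP : P.IsPrime) (hQ : ¬ Q ≤ P) (n : ℕ) : Submodule.colon P (Q ^ n : Ideal A) = P := by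
  refine le_antisymm ?_ fun a ha => Submodule.mem_colon.mpr fun q _ => ?_
  · intro a ha
    obtain ⟨q, hqQ, hqP⟩ := SetLike.not_le_iff_exists.mp hQ
    have hqn : q ^ n ∈ Q ^ n := Ideal.pow_mem_pow hqQ n
    have hmul := Submodule.mem_colon.mp ha (q ^ n) hqn
    rw [smul_eq_mul] at hmul
    rcases hP.mem_or_mem hmul with h | h
    · exact h
    · exact absurd (hP.mem_of_pow_mem n h) hqP
  · rw [smul_eq_mul]
    exact P.mul_mem_right q ha

/-! ## §1 The blow-up along a member of an snc family is the identity; its transforms -/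

/-- A member of an snc family is an effective Cartier divisor, so **the identity is a blow-up along it**
(Görtz–Wedhorn (13.19)). [cite: GortzWedhorn2020, (13.19) p. 413] -/
theorem isBlowup_id_of_mem [IsLocallyNoetherian X] {𝓔 : List X.IdealSheafData} (h𝓔 : HasSNC 𝓔)
    {S : X.IdealSheafData} (hS : S ∈ 𝓔) : IsBlowup (𝟙 X) S :=
  IsBlowup.id ((h𝓔.hasSNCWith_of_mem hS).isEffectiveCartier_of_mem hS)

/-- Along the identity, **the controlled transform of weight one is the colon ideal `(𝔟 : S)`**. [folklore] -/
theorem controlledTransform_id (S 𝔟 : X.IdealSheafData) :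
    controlledTransform (𝟙 X) S 𝔟 1 = colon 𝔟 S := by
  rw [controlledTransform, Scheme.IdealSheafData.comap_id, Scheme.IdealSheafData.comap_id, pow_one]

/-- Along the identity, **the strict transform of the centre itself is the unit ideal**. [folklore] -/
theorem strictTransformIdeal_id_self (S : X.IdealSheafData) : strictTransformIdeal (𝟙 X) S S = ⊤ := by
  refine top_le_iff.mp ?_
  rw [strictTransformIdeal, Scheme.IdealSheafData.comap_id]
  refine le_trans ?_ (le_iSup (fun n : ℕ => colon S (S ^ n)) 1)
  rw [pow_one, le_colon_iff]
  exact fun U => Ideal.mul_le_right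

/-- Along the identity, **the strict transform of ANOTHER member `G ≠ S` of the snc family is `G` itself**
(`(G : Sⁿ) = G` stalkwise: distinct snc members through a point have incomparable prime stalks). [folklore] -/
theorem strictTransformIdeal_id_of_ne [IsLocallyNoetherian X] {𝓔 : List X.IdealSheafData} (h𝓔 : HasSNC 𝓔)
    {S G : X.IdealSheafData} (hS : S ∈ 𝓔) (hG : G ∈ 𝓔) (hne : G ≠ S) :
    strictTransformIdeal (𝟙 X) S G = G := by
  rw [strictTransformIdeal, Scheme.IdealSheafData.comap_id, Scheme.IdealSheafData.comap_id]
  refine le_antisymm (iSup_le fun n => le_of_forall_stalkIdeal_le fun x => ?_) ?_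
  · rw [stalkIdeal_colon, stalkIdeal_pow]
    by_cases hxG : x ∈ G.support
    · by_cases hxS : x ∈ S.support
      · rw [colon_pow_eq_self_of_isPrime_of_not_le (h𝓔.isPrime_stalkIdeal hG hxG)
          (stalkIdeal_not_le_of_ne h𝓔 hS hG hne.symm hxS hxG) n]
      · rw [stalkIdeal_eq_top_of_not_mem_support hxS, Ideal.top_pow, Submodule.top_coe, Submodule.colon_univ]
    · rw [stalkIdeal_eq_top_of_not_mem_support hxG]
      exact le_top
  · exact le_trans (by rw [pow_zero, Scheme.IdealSheafData.one_eq_top, colon_top])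
      (le_iSup (fun n : ℕ => colon G (S ^ n)) 0)

/-- **`(S · M : S) = M` for an effective Cartier divisor `S`** (cancel `S` from `S · (S·M : S) = S · M`). [folklore] -/
theorem colon_mul_of_isEffectiveCartier [IsLocallyNoetherian X] {S : X.IdealSheafData} (hS : IsEffectiveCartier S)
    (M : X.IdealSheafData) : colon (S * M) S = M := by
  refine hS.eq_of_mul_eq_mul ?_
  have h := pow_mul_colon_eq_of_le (L := S * M) hS (μ := 1) (by rw [pow_one]; exact fun U => Ideal.mul_le_right)
  rwa [pow_one] at h

/-- **One exponent comes off**: `((S^{e+1} · Π) : S) = S^e · Π` for an effective Cartier `S`, in `monomialIdeal` form.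
[cite: Kollar2007, (3.111) Step 3] -/
theorem colon_monomialIdeal_cons_succ [IsLocallyNoetherian X] {S : X.IdealSheafData} (hS : IsEffectiveCartier S) (e : ℕ)
    (𝒮 : List (X.IdealSheafData × ℕ)) :
    colon (monomialIdeal ((S, e + 1) :: 𝒮)) S = monomialIdeal ((S, e) :: 𝒮) := by
  rw [monomialIdeal_cons, monomialIdeal_cons, pow_succ', mul_assoc]
  exact colon_mul_of_isEffectiveCartier hS _

/-- With exponent zero the head contributes nothing: `S⁰ · Π = Π`. [folklore] -/
theorem monomialIdeal_cons_zero (S : X.IdealSheafData) (𝒮 : List (X.IdealSheafData × ℕ)) :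
    monomialIdeal ((S, 0) :: 𝒮) = monomialIdeal 𝒮 := by
  rw [monomialIdeal_cons, pow_zero, one_mul]

/-! ## §2 The clauses of one peel -/

/-- `Π_j S_j^{e_j} ≤ S` as soon as `(S, e)` occurs with `e ≥ 1`. [folklore] -/
theorem monomialIdeal_le_of_mem {𝒮 : List (X.IdealSheafData × ℕ)} {S : X.IdealSheafData} {e : ℕ}
    (h : (S, e) ∈ 𝒮) (he : 1 ≤ e) : monomialIdeal 𝒮 ≤ S := by
  induction 𝒮 with
  | nil => exact absurd h List.not_mem_nil
  | cons p 𝒮 ih =>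
    rw [monomialIdeal_cons]
    rcases List.mem_cons.mp h with hp | hp
    · -- `p = (S, e)`: `S^e · Π ≤ S^e ≤ S`
      rw [← hp]
      refine le_trans (fun U => Ideal.mul_le_right) ?_
      change S ^ e ≤ S
      obtain ⟨k, rfl⟩ := Nat.exists_eq_add_of_le he
      rw [pow_add, pow_one]
      exact fun U => Ideal.mul_le_right
    · exact le_trans (fun U => Ideal.mul_le_left) (ih hp)

/-- **snc of a sub-family WITH the centre `S`**, `S` a member of the ambient snc family. [folklore] -/
theorem hasSNCWith_of_subset_of_mem {𝓔 ℬ : List X.IdealSheafData} (h𝓔 : HasSNC 𝓔) (hℬ : ∀ D ∈ ℬ, D ∈ 𝓔)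
    {S : X.IdealSheafData} (hS : S ∈ 𝓔) : HasSNCWith ℬ S := by
  intro x
  obtain ⟨hreg, u, hu, ⟨ι, hι, hιD⟩, hC⟩ := h𝓔.hasSNCWith_of_mem hS x
  refine ⟨hreg, u, hu, ⟨fun D => ι ⟨D.1, hℬ _ D.2.1, D.2.2⟩, fun D₁ D₂ heq => ?_,
    fun D => hιD ⟨D.1, hℬ _ D.2.1, D.2.2⟩⟩, hC⟩
  have e := congrArg Subtype.val (hι heq)
  exact Subtype.ext e

/-- **Uniform incidence of a boundary with the centre `S` on the single piece `V(S)`**: a boundary member equal to `S`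
contains the centre everywhere; any other member of the snc family `S :: boundary` has a stalk incomparable with `S_x`
at every common point. [folklore] -/
theorem uniformPieces_single_of_hasSNC {𝒟 : List (X.IdealSheafData × ℕ)} {S : X.IdealSheafData}
    (h : HasSNC (S :: boundaryOf 𝒟)) : UniformPieces 𝒟 S [S.support] := by
  intro Z hZ K hK
  rw [List.mem_singleton] at hZ
  subst hZ
  by_cases hKS : K = S
  · subst hKS
    exact Or.inl fun x _ => le_rfl
  · refine Or.inr fun x hx hxK => ?_
    exact stalkIdeal_not_le_of_ne h (List.mem_cons_of_mem _ hK) List.mem_cons_self hKS hxK hx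

/-- **At a point of ORDER ONE the ideal IS the centre**: if `𝔟 ≤ S`, `x ∈ V(S)`, `S_x` is principal and `𝔟_x ⊄ 𝔪_x²`,
then `𝔟_x = S_x` (some `g·s ∈ 𝔟_x` is not in `𝔪²`, so `g` is a unit). No regularity needed. [folklore] -/
theorem stalkIdeal_eq_of_le_of_not_le_sq {𝔟 S : X.IdealSheafData} (hle : 𝔟 ≤ S) {x : X} (hx : x ∈ S.support)
    (hs : ∃ s, stalkIdeal S x = Ideal.span {s})
    (hord : ¬ stalkIdeal 𝔟 x ≤ maximalIdeal (X.presheaf.stalk x) ^ 2) : stalkIdeal 𝔟 x = stalkIdeal S x := by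
  obtain ⟨s, hs⟩ := hs
  have hsm : s ∈ maximalIdeal (X.presheaf.stalk x) :=
    (mem_support_iff_stalkIdeal_le S x).mp hx (hs ▸ Ideal.mem_span_singleton_self s)
  refine le_antisymm (stalkIdeal_mono hle x) ?_
  obtain ⟨f, hf𝔟, hf2⟩ := SetLike.not_le_iff_exists.mp hord
  have hfS : f ∈ Ideal.span {s} := hs ▸ stalkIdeal_mono hle x hf𝔟
  obtain ⟨g, rfl⟩ := Ideal.mem_span_singleton'.mp hfS
  -- `g` is a unit: otherwise `g · s ∈ 𝔪²`
  have hg : IsUnit g := by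
    by_contra hg
    have hgm : g ∈ maximalIdeal _ := (IsLocalRing.mem_maximalIdeal g).mpr hg
    exact hf2 (by rw [pow_two]; exact Ideal.mul_mem_mul hgm hsm)
  rw [hs, Ideal.span_singleton_le_iff_mem]
  have : ↑hg.unit⁻¹ * (g * s) ∈ stalkIdeal 𝔟 x := Ideal.mul_mem_left _ _ hf𝔟
  rwa [← mul_assoc, IsUnit.val_inv_mul, one_mul] at this

/-- **JOINT at a non-coincidence point**: replacing the head `S` of a pointwise-snc family by an ideal sheaf `𝔟` with
THE SAME STALK at `z` keeps simple normal crossings with the centre at `z`, provided `S` is not also listed in the tail.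
[cite: Kollar2007, Def. 3.24] -/
theorem sncWithAt_cons_of_stalkIdeal_eq {S 𝔟 C : X.IdealSheafData} {𝒢 : List X.IdealSheafData} {z : X}
    (h : DepthSNC.SNCWithAt (S :: 𝒢) C z) (hz : z ∈ S.support) (heq : stalkIdeal 𝔟 z = stalkIdeal S z)
    (hS𝒢 : S ∉ 𝒢) : DepthSNC.SNCWithAt (𝔟 :: 𝒢) C z := by
  classical
  obtain ⟨hreg, d, v, hd, hv, ⟨ι, hι, hιD⟩, hC⟩ := h
  have hmemS : S ∈ S :: 𝒢 := List.mem_cons_self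
  have htail : ∀ D : {D : X.IdealSheafData // D ∈ 𝔟 :: 𝒢 ∧ z ∈ D.support}, D.1 ≠ 𝔟 → D.1 ∈ 𝒢 := fun D hD =>
    (List.mem_cons.mp D.2.1).resolve_left hD
  -- the new label map: `𝔟 ↦ ι S`, a tail member `G ↦ ι G`
  let ι' : {D : X.IdealSheafData // D ∈ 𝔟 :: 𝒢 ∧ z ∈ D.support} → Fin d := fun D =>
    if hD : D.1 = 𝔟 then ι ⟨S, hmemS, hz⟩ else ι ⟨D.1, List.mem_cons_of_mem _ (htail D hD), D.2.2⟩
  have hι'D : ∀ D, stalkIdeal D.1 z = Ideal.span {v (ι' D)} := by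
    intro D
    by_cases hD : D.1 = 𝔟
    · simp only [ι', hD, dif_pos]
      rw [heq]
      exact hιD ⟨S, hmemS, hz⟩
    · simp only [ι', hD, dif_neg, not_false_eq_true]
      exact hιD ⟨D.1, List.mem_cons_of_mem _ (htail D hD), D.2.2⟩
  refine ⟨hreg, d, v, hd, hv, ⟨ι', fun D₁ D₂ h12 => ?_, hι'D⟩, hC⟩
  -- injectivity: equal labels of distinct old members are impossible; the only new coincidence is `𝔟` with itself
  by_cases h1 : D₁.1 = 𝔟 <;> by_cases h2 : D₂.1 = 𝔟
  · exact Subtype.ext (h1.trans h2.symm)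
  · exfalso
    simp only [ι', h1, h2, dif_pos, dif_neg, not_false_eq_true] at h12
    have h' : S = D₂.1 := congrArg Subtype.val (hι h12)
    exact hS𝒢 (by rw [h']; exact htail D₂ h2)
  · exfalso
    simp only [ι', h1, h2, dif_pos, dif_neg, not_false_eq_true] at h12
    have h' : D₁.1 = S := congrArg Subtype.val (hι h12)
    exact hS𝒢 (by rw [← h']; exact htail D₁ h1)
  · simp only [ι', h1, h2, dif_neg, not_false_eq_true] at h12
    have e := congrArg Subtype.val (hι h12)
    exact Subtype.ext e

/-- **The family `S :: 𝒢` has simple normal crossings WITH the centre `S` at every point**, if `S :: 𝒢` is drawn from an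
snc family. [folklore] -/
theorem sncWithAt_cons_self {𝓔 𝒢 : List X.IdealSheafData} (h𝓔 : HasSNC 𝓔) (h𝒢 : ∀ D ∈ 𝒢, D ∈ 𝓔)
    {S : X.IdealSheafData} (hS : S ∈ 𝓔) (z : X) : DepthSNC.SNCWithAt (S :: 𝒢) S z :=
  (hasSNCWith_of_subset_of_mem h𝓔 (fun D hD => (List.mem_cons.mp hD).elim (fun h => h ▸ hS) (h𝒢 D)) hS).sncWithAt z

/-! ## §3 Bookkeeping for the next peel -/

/-- **Families drawn from an snc family and the unit ideal stay snc** (the unit ideal passes through no point).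
[folklore] -/
theorem hasSNC_of_forall_mem_or_eq_top {𝓔 𝓔' : List X.IdealSheafData} (h𝓔 : HasSNC 𝓔)
    (h : ∀ D ∈ 𝓔', D ∈ 𝓔 ∨ D = ⊤) : HasSNC 𝓔' := by
  intro x
  obtain ⟨hreg, u, hu, ⟨ι, hι, hιD⟩, hC⟩ := h𝓔 x
  have hmem : ∀ D : {D : X.IdealSheafData // D ∈ 𝓔' ∧ x ∈ D.support}, D.1 ∈ 𝓔 := fun D =>
    (h D.1 D.2.1).elim id fun htop => by
      exfalso
      have hx := D.2.2
      rw [htop, Scheme.IdealSheafData.support_top] at hx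
      exact hx
  refine ⟨hreg, u, hu, ⟨fun D => ι ⟨D.1, hmem D, D.2.2⟩, fun D₁ D₂ heq => ?_, fun D => hιD ⟨D.1, hmem D, D.2.2⟩⟩,
    hC⟩
  have e := congrArg Subtype.val (hι heq)
  exact Subtype.ext e

/-- **The boundary after a peel along the identity**: the strict transforms of the old members are the old members or
the unit ideal, and the new member is `S` (`S.comap (𝟙 X) = S`); so the new boundary list is drawn from the old snc
family and `⊤`. [folklore] -/
theorem mem_or_eq_top_of_mem_boundaryOf_peel [IsLocallyNoetherian X] {𝓔 : List X.IdealSheafData} (h𝓔 : HasSNC 𝓔)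
    {S : X.IdealSheafData} (hS : S ∈ 𝓔) {𝒟 : List (X.IdealSheafData × ℕ)} (h𝒟 : ∀ D ∈ boundaryOf 𝒟, D ∈ 𝓔) (a : ℕ)
    {D : X.IdealSheafData}
    (hD : D ∈ boundaryOf (𝒟.map (fun p => (strictTransformIdeal (𝟙 X) S p.1, p.2)) ++ [(S.comap (𝟙 X), a)])) :
    D ∈ 𝓔 ∨ D = ⊤ := by
  rw [boundaryOf, List.map_append, List.mem_append, List.map_map] at hD
  rcases hD with hD | hD
  · obtain ⟨p, hp, rfl⟩ := List.mem_map.mp hD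
    have hp1 : p.1 ∈ 𝓔 := h𝒟 p.1 (fst_mem_boundaryOf hp)
    by_cases hpS : p.1 = S
    · right
      change strictTransformIdeal (𝟙 X) S p.1 = ⊤
      rw [hpS, strictTransformIdeal_id_self]
    · left
      change strictTransformIdeal (𝟙 X) S p.1 ∈ 𝓔
      rw [strictTransformIdeal_id_of_ne h𝓔 hS hp1 hpS]
      exact hp1
  · left
    rw [List.map_singleton, List.mem_singleton] at hD
    rw [hD, Scheme.IdealSheafData.comap_id]
    exact hS

end DepthSep

end Summit.ResolutionOfSingularities.ResolutionOfSingularities.Theorems
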